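import Summits.MatrixMultiplication.OmegaCensus.SmallFormats.InvertiblePointLineColumns
import HarnessLib

/-!
# ω-census family (a): the NEAR-FRAME law (one term short of a frame) at an invertible point of `⟨m,m,n⟩`

Cell `pub-omega` (unit `pub-omega-tensor-g25`), topic `Summits/MatrixMultiplication/OmegaCensus` (sub-folder `SmallFormats`).
Framing (verbatim): lottery ticket; floor = certified bounds/negative ranges. HONEST FRAMING: elementary structural identities over an
arbitrary field, continuing `InvertiblePointFrame` (p434823, the saturated case `|O| = m·n`) to the case `|O| = m·n + 1` — the
situation at EVERY invertible point of the 56 'no-IP' X-marginal orbits of the `𝔽₃` `⟨2,2,6⟩ @ 20` census (tensor gens 23–25,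
`NEAR-FRAME.md`), which are the whole residue of that census after the IP-orbits were excluded. This file is the kernel form of the
desk reduction (N1)–(N4) + §6 of `NEAR-FRAME.md` behind the census rows Pa24/Pa25; it is not a rank bound and says nothing on `ω`.

**Setting (point moved to `X₀ = 1`).** `β` computes `X ↦ XY` (`X ∈ k^{m×m}`, `Y ∈ k^{m×n}`), `O` = the terms with `f_i(1) ≠ 0`,
`|O| = m·n + 1`; write `γ_s := f_s(1)·g_s`, `c_s := f_s/f_s(1)` (`s ∈ O`), `Z := Oᶜ`.
* (`exists_nearFrame`) there are `ρ, σ : O → k`, `ρ ≠ 0`, with `Σ_{j∈O} ρ_j W_j = 0`, `γ_s(W_j) = δ_{sj} + ρ_s σ_j` and `Σ_s ρ_s σ_s = −1`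
  (the off terms are a frame up to ONE rank-one defect);
* (`near_footprint_w_eq`) for `j ∈ O` and every `X`: `X W_j − c_j(X) W_j − σ_j·D(X) = Σ_{t∈Z} f_t(X) g_t(W_j) W_t`,
  `D(X) := Σ_{s∈O} ρ_s c_s(X) W_s`;
* (`nearBasis_footprint_eq`, `linearIndependent_nearBasis`, `nearBasis_dual`) for any `j₀ ∈ O` with `σ_{j₀} ≠ 0` the vectors
  `W'_j := W_j − (σ_j/σ_{j₀}) W_{j₀}` (`j ∈ O ∖ {j₀}`) form a BASIS of `k^{m×n}` with dual basis `{γ_j}` and EXACT footprints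
  `X W'_j − c_j(X) W'_j = (σ_j/σ_{j₀})(c_j(X) − c_{j₀}(X))·W_{j₀} + Σ_{t∈Z} f_t(X) g_t(W'_j) W_t ∈ k·W_{j₀} + span{W_t : t ∈ Z, f_t(X) ≠ 0}`
  — so the footprint filter / frame-law search of the saturated case applies VERBATIM with the off multiset minus one term of the class of
  `j₀` and the `(|Z|+1)`-dimensional target space `span{W_t : t∈Z} + k·W_{j₀}` (this is reduction (N4));
* (`sum_sigma_gamma_eq_zero`, `mul_eq_nearBrent`, `nearDefect_one`) Brent's identity in the `W'` frame:
  `X Y = Σ_{j≠j₀} f_j(X) g_j(Y) W'_j + e(X,Y)·W_{j₀} + Σ_{t∈Z} f_t(X) g_t(Y) W_t`, `e(X,Y) := Σ_{s∈O} (σ_s/σ_{j₀}) f_s(X) g_s(Y)`,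
  `e(1,·) = 0` — a 12-term frame plus the `Z`-terms plus ONE defect term along the fixed vector `W_{j₀}`;
* (`near_transport`) on `K₀ := ⋂_{t∈Z} ker g_t`: `f_s(1) g_s(XW) = f_s(X) g_s(W) + ρ_s · Σ_{s'} σ_{s'} f_{s'}(X) g_{s'}(W)`;
* the `m = 2` LINE-COLUMN LAW WITH DEFECT (`W_{ij} = w₀ · e(ζ e_iᵀ, W)` on `K₀` for a line column `j`) is in the companion file
  `InvertiblePointNearLineColumns`.
Controls (outside Lean, tensor g24 `nearcontrol.py`, ENG1 g26 `control223_near.py`, tensor g25 `nearcontrol_search.py`): on the tree's real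
`⟨2,2,3⟩@11` and `⟨2,2,5⟩@18` schemes mod 3 every identity above holds at every invertible point with `|Z| = r − 2n − 1`.
-/

namespace Summit.MatrixMultiplication.OmegaCensus.SmallFormats

open Module Matrix Literature.Computability.AlgebraicComplexity

variable {k : Type*} [Field k] {m n : ℕ} {ι : Type*} [Fintype ι]

/-- `det 1` is a unit (any size). -/
theorem isUnit_det_one_fin : IsUnit (1 : Matrix (Fin m) (Fin m) k).det := by
  rw [Matrix.det_one]; exact isUnit_one

section NearFrame

variable (β : BilinComp (mulBilin k m m n) ι) (O : Finset ι)

/-- **(N1)** At `X₀ = 1`: `Y = Σ_{s∈O} f_s(1) g_s(Y) · W_s` for every `Y` (`id = Σ_{s∈O} W_s ⊗ γ_s`). -/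
theorem eq_sum_off_one (hO : ∀ i, i ∉ O → β.f i 1 = 0) (Y : Matrix (Fin m) (Fin n) k) :
    Y = ∑ s ∈ O, (β.f s 1 * β.g s Y) • β.w s := by
  have h := mul_eq_sum_off β 1 O hO Y
  rwa [Matrix.one_mul] at h

/-- **Near frame: the rank-one defect.** If `|O| = m·n + 1` at `X₀ = 1`, there are `ρ, σ` (supported on `O`, `ρ ≠ 0` on `O`) with
`Σ_{j∈O} ρ_j W_j = 0`, `f_s(1) g_s(W_j) = δ_{sj} + ρ_s σ_j` (`s, j ∈ O`) and `Σ_{s∈O} ρ_s σ_s = −1`.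
Proof: the `W_s` (`s ∈ O`) span `k^{m×n}` (`top_le_span_w_off`), so their relation space is one-dimensional, spanned by some `ρ ≠ 0`;
by (N1) at `Y = W_s` each vector `(f_j(1) g_j(W_s) − δ_{js})_j` is a relation, hence `= σ_s·ρ`; applying `f_s(1) g_s` to the relation
`ρ` gives `ρ_s (1 + ρ·σ) = 0`. -/
theorem exists_nearFrame [DecidableEq ι] (hO : ∀ i, i ∉ O → β.f i 1 = 0) (hcard : O.card = m * n + 1) :
    ∃ ρ σ : ι → k, (∃ s ∈ O, ρ s ≠ 0) ∧ (∑ j ∈ O, ρ j • β.w j = 0) ∧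
      (∀ s ∈ O, ∀ j ∈ O, β.f s 1 * β.g s (β.w j) = (if s = j then 1 else 0) + ρ s * σ j) ∧
      (∑ s ∈ O, ρ s * σ s = -1) := by
  classical
  -- the coefficient map `a ↦ Σ_{j∈O} a_j W_j` on `O → k` is onto `k^{m×n}`, so its kernel is a line
  let Φ : (O → k) →ₗ[k] Matrix (Fin m) (Fin n) k := Fintype.linearCombination k (fun j : O => β.w j)
  have hΦapply : ∀ a : O → k, Φ a = ∑ j : O, a j • β.w (j : ι) := fun a => Fintype.linearCombination_apply _ _ a
  have hsurj : LinearMap.range Φ = ⊤ := by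
    rw [Fintype.range_linearCombination]
    exact top_le_iff.mp (top_le_span_w_off β 1 isUnit_det_one_fin O hO)
  have hker : finrank k (LinearMap.ker Φ) = 1 := by
    have h1 := LinearMap.finrank_range_add_finrank_ker Φ
    rw [hsurj, finrank_top, finrank_matrix_fin, finrank_fintype_fun_eq_card, Fintype.card_coe, hcard] at h1
    omega
  haveI : Nontrivial (LinearMap.ker Φ) := Module.nontrivial_of_finrank_eq_succ hker
  obtain ⟨ρ', hρ'⟩ := exists_ne (0 : LinearMap.ker Φ)
  have hline : ∀ v : LinearMap.ker Φ, ∃ c : k, c • ρ' = v := (finrank_eq_one_iff_of_nonzero' ρ' hρ').mp hker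
  -- for each `s ∈ O`, the vector `(f_j(1) g_j(W_s) − δ_{js})_j` is a relation
  have ha : ∀ s ∈ O, (fun j : O => β.f j 1 * β.g j (β.w s) - if (j : ι) = s then 1 else 0) ∈ LinearMap.ker Φ := by
    intro s hs
    rw [LinearMap.mem_ker, hΦapply]
    have h := eq_sum_off_one β O hO (β.w s)
    simp only [sub_smul, Finset.sum_sub_distrib]
    rw [Finset.sum_coe_sort O (fun j => (β.f j 1 * β.g j (β.w s)) • β.w j), ← h,
      Finset.sum_coe_sort O (fun j => (if j = s then (1 : k) else 0) • β.w j)]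
    simp_rw [ite_smul, one_smul, zero_smul]
    rw [Finset.sum_ite_eq' O s, if_pos hs, sub_self]
  choose! c hc using fun s (hs : s ∈ O) => hline ⟨_, ha s hs⟩
  let ρ : ι → k := fun i => if h : i ∈ O then (ρ' : O → k) ⟨i, h⟩ else 0
  have hρO : ∀ j : O, ρ j = (ρ' : O → k) j := fun j => by simp only [ρ, dif_pos j.2]
  -- (1) `ρ ≠ 0` on `O`
  have hρne : ∃ s ∈ O, ρ s ≠ 0 := by
    by_contra hall
    push Not at hall
    apply hρ'
    apply Subtype.ext
    funext j
    rw [← hρO j, hall j j.2]; rfl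
  -- (2) `ρ` is a relation
  have hrel : ∑ j ∈ O, ρ j • β.w j = 0 := by
    have h0 : Φ ρ' = 0 := LinearMap.mem_ker.mp ρ'.2
    rw [hΦapply] at h0
    rw [← Finset.sum_coe_sort O (fun j => ρ j • β.w j)]
    simp_rw [hρO]
    exact h0
  -- (3) the rank-one identity
  have hM : ∀ s ∈ O, ∀ j ∈ O, β.f s 1 * β.g s (β.w j) = (if s = j then 1 else 0) + ρ s * c j := by
    intro s hs j hj
    have h := congrArg (fun v : LinearMap.ker Φ => (v : O → k) ⟨s, hs⟩) (hc j hj)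
    simp only [SetLike.val_smul, Pi.smul_apply, smul_eq_mul] at h
    rw [← hρO ⟨s, hs⟩] at h
    -- `h : c j * ρ s = f_s(1) g_s(W_j) − δ`
    split_ifs at h ⊢ with hsj
    · linear_combination -h
    · linear_combination -h
  refine ⟨ρ, c, hρne, hrel, hM, ?_⟩
  -- (4) `ρ·σ = −1`: apply `f_{s₀}(1) g_{s₀}` to the relation
  obtain ⟨s₀, hs₀, hρs₀⟩ := hρne
  have h := congrArg (fun Y => β.f s₀ 1 * β.g s₀ Y) hrel
  simp only [map_sum, map_smul, smul_eq_mul, map_zero, mul_zero, Finset.mul_sum] at h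
  have h' : ∑ j ∈ O, ρ j * (β.f s₀ 1 * β.g s₀ (β.w j)) = 0 := by
    rw [← h]; exact Finset.sum_congr rfl fun j _ => by ring
  rw [Finset.sum_congr rfl fun j hj => by rw [hM s₀ hs₀ j hj]] at h'
  simp only [mul_add, Finset.sum_add_distrib, mul_ite, mul_one, mul_zero] at h'
  rw [Finset.sum_ite_eq O s₀, if_pos hs₀] at h'
  have h'' : ρ s₀ * (1 + ∑ j ∈ O, ρ j * c j) = 0 := by
    rw [mul_add, mul_one, Finset.mul_sum, ← h']
    congr 1
    exact Finset.sum_congr rfl fun j _ => by ring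
  rcases mul_eq_zero.mp h'' with h0 | h0
  · exact absurd h0 hρs₀
  · linear_combination h0

/-- **(N3) Output footprint with one defect.** With `ρ, σ` as in `exists_nearFrame`, for `j ∈ O` and every `X`:
`X W_j − c_j(X) W_j − σ_j · D(X) = Σ_{t∉O} f_t(X) g_t(W_j) W_t`, where `D(X) := Σ_{s∈O} ρ_s c_s(X) W_s` and
`c_s(X) := f_s(X) f_s(1)⁻¹` (Brent at `(X, W_j)`, the `O`-part evaluated with `f_s(1) g_s(W_j) = δ_{sj} + ρ_s σ_j`). -/
theorem near_footprint_w_eq [DecidableEq ι] (hO' : ∀ i ∈ O, β.f i 1 ≠ 0) {ρ σ : ι → k}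
    (hM : ∀ s ∈ O, ∀ j ∈ O, β.f s 1 * β.g s (β.w j) = (if s = j then 1 else 0) + ρ s * σ j)
    {j : ι} (hj : j ∈ O) (X : Matrix (Fin m) (Fin m) k) :
    X * β.w j - (β.f j X * (β.f j 1)⁻¹) • β.w j - σ j • ∑ s ∈ O, (ρ s * (β.f s X * (β.f s 1)⁻¹)) • β.w s =
      ∑ t ∈ Finset.univ \ O, (β.f t X * β.g t (β.w j)) • β.w t := by
  have h := β.map_eq_sum X (β.w j)
  rw [mulBilin_apply] at h
  have hcoef : ∀ s ∈ O, (β.f s X * β.g s (β.w j)) • β.w s =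
      (if s = j then β.f j X * (β.f j 1)⁻¹ else 0) • β.w s + σ j • ((ρ s * (β.f s X * (β.f s 1)⁻¹)) • β.w s) := by
    intro s hs
    have hg : β.g s (β.w j) = (β.f s 1)⁻¹ * ((if s = j then 1 else 0) + ρ s * σ j) := by
      rw [← hM s hs j hj, ← mul_assoc, inv_mul_cancel₀ (hO' s hs), one_mul]
    rw [smul_smul, ← add_smul]
    congr 1
    rw [hg]
    split_ifs with hsj
    · subst hsj; ring
    · ring
  have hOsum : ∑ s ∈ O, (β.f s X * β.g s (β.w j)) • β.w s =
      (β.f j X * (β.f j 1)⁻¹) • β.w j + σ j • ∑ s ∈ O, (ρ s * (β.f s X * (β.f s 1)⁻¹)) • β.w s := by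
    rw [Finset.sum_congr rfl hcoef, Finset.sum_add_distrib, ← Finset.smul_sum]
    congr 1
    simp_rw [ite_smul, zero_smul]
    rw [Finset.sum_ite_eq' O j, if_pos hj]
  rw [h, ← Finset.sum_sdiff (Finset.subset_univ O), hOsum]
  abel

/-- **(N4a) Exact footprints of the reduced basis.** If `σ_j = l·σ_{j₀}` then the vector `W'_j := W_j − l·W_{j₀}` has an EXACT
footprint up to the single direction `W_{j₀}`: `X W'_j − c_j(X) W'_j = l (c_j(X) − c_{j₀}(X))·W_{j₀} + Σ_{t∉O} f_t(X) g_t(W'_j) W_t`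
(the defect terms `σ_j D(X)` and `l σ_{j₀} D(X)` cancel). With `σ_{j₀} ≠ 0` and `l = σ_j/σ_{j₀}` this is reduction (N4). -/
theorem nearBasis_footprint_eq [DecidableEq ι] (hO' : ∀ i ∈ O, β.f i 1 ≠ 0) {ρ σ : ι → k}
    (hM : ∀ s ∈ O, ∀ j ∈ O, β.f s 1 * β.g s (β.w j) = (if s = j then 1 else 0) + ρ s * σ j)
    {j₀ : ι} (hj₀ : j₀ ∈ O) {j : ι} (hj : j ∈ O) {l : k} (hl : σ j = l * σ j₀) (X : Matrix (Fin m) (Fin m) k) :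
    X * (β.w j - l • β.w j₀) - (β.f j X * (β.f j 1)⁻¹) • (β.w j - l • β.w j₀) =
      (l * (β.f j X * (β.f j 1)⁻¹ - β.f j₀ X * (β.f j₀ 1)⁻¹)) • β.w j₀ +
        ∑ t ∈ Finset.univ \ O, (β.f t X * β.g t (β.w j - l • β.w j₀)) • β.w t := by
  have hj' := near_footprint_w_eq β O hO' hM hj X
  have hj₀' := near_footprint_w_eq β O hO' hM hj₀ X
  rw [hl] at hj'
  set D := ∑ s ∈ O, (ρ s * (β.f s X * (β.f s 1)⁻¹)) • β.w s with hD
  have hR : ∑ t ∈ Finset.univ \ O, (β.f t X * β.g t (β.w j - l • β.w j₀)) • β.w t =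
      ∑ t ∈ Finset.univ \ O, (β.f t X * β.g t (β.w j)) • β.w t -
        l • ∑ t ∈ Finset.univ \ O, (β.f t X * β.g t (β.w j₀)) • β.w t := by
    rw [Finset.smul_sum, ← Finset.sum_sub_distrib]
    refine Finset.sum_congr rfl fun t _ => ?_
    rw [map_sub, map_smul, smul_eq_mul, smul_smul, ← sub_smul]
    congr 1; ring
  rw [hR, ← hj', ← hj₀', Matrix.mul_sub, Matrix.mul_smul]
  module

/-- **(N4a, membership form).** Under the same hypotheses the footprint of `W'_j = W_j − l W_{j₀}` lies in
`span({W_{j₀}} ∪ {W_t : t ∉ O, f_t(X) ≠ 0})` — a space of dimension `≤ |Z_X| + 1`; this is the hypothesis of the saturated-case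
footprint filter with the target space enlarged by the one vector `W_{j₀}`. -/
theorem nearBasis_footprint_mem [DecidableEq ι] (hO' : ∀ i ∈ O, β.f i 1 ≠ 0) {ρ σ : ι → k}
    (hM : ∀ s ∈ O, ∀ j ∈ O, β.f s 1 * β.g s (β.w j) = (if s = j then 1 else 0) + ρ s * σ j)
    {j₀ : ι} (hj₀ : j₀ ∈ O) {j : ι} (hj : j ∈ O) {l : k} (hl : σ j = l * σ j₀) (X : Matrix (Fin m) (Fin m) k) :
    X * (β.w j - l • β.w j₀) - (β.f j X * (β.f j 1)⁻¹) • (β.w j - l • β.w j₀) ∈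
      Submodule.span k (insert (β.w j₀) (β.w '' {t | t ∉ O ∧ β.f t X ≠ 0})) := by
  rw [nearBasis_footprint_eq β O hO' hM hj₀ hj hl X]
  refine Submodule.add_mem _ (Submodule.smul_mem _ _ (Submodule.subset_span (Set.mem_insert _ _))) ?_
  refine Submodule.sum_mem _ fun t ht => ?_
  rw [Finset.mem_sdiff] at ht
  by_cases hft : β.f t X = 0
  · rw [hft, zero_mul, zero_smul]; exact Submodule.zero_mem _
  · exact Submodule.smul_mem _ _ (Submodule.subset_span (Set.mem_insert_of_mem _ ⟨t, ⟨ht.2, hft⟩, rfl⟩))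

/-- **Dual basis.** If `σ_j = l_j σ_{j₀}` for all `j ∈ O`, then for `i ∈ O`, `i ≠ j₀` and `j ∈ O`:
`f_i(1) g_i(W_j − l_j W_{j₀}) = δ_{ij}` — the forms `γ_i` (`i ≠ j₀`) are EXACTLY dual to the reduced basis (NEAR-FRAME §6). -/
theorem nearBasis_dual [DecidableEq ι] {ρ σ l : ι → k}
    (hM : ∀ s ∈ O, ∀ j ∈ O, β.f s 1 * β.g s (β.w j) = (if s = j then 1 else 0) + ρ s * σ j)
    {j₀ : ι} (hj₀ : j₀ ∈ O) (hl : ∀ j ∈ O, σ j = l j * σ j₀) {i : ι} (hi : i ∈ O) (hij₀ : i ≠ j₀) {j : ι} (hj : j ∈ O) :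
    β.f i 1 * β.g i (β.w j - l j • β.w j₀) = if i = j then 1 else 0 := by
  rw [map_sub, map_smul, smul_eq_mul, mul_sub, mul_left_comm, hM i hi j hj, hM i hi j₀ hj₀, if_neg hij₀, hl j hj]
  ring

/-- **The σ-relation among the forms.** If `ρ ≠ 0` on `O` then `Σ_{s∈O} σ_s f_s(1) g_s = 0` (apply `γ_{s₀}` to (N1):
`γ_{s₀}(Y) = Σ_j γ_j(Y) γ_{s₀}(W_j) = γ_{s₀}(Y) + ρ_{s₀} Σ_j σ_j γ_j(Y)`). -/
theorem sum_sigma_gamma_eq_zero [DecidableEq ι] (hO : ∀ i, i ∉ O → β.f i 1 = 0) {ρ σ : ι → k}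
    (hM : ∀ s ∈ O, ∀ j ∈ O, β.f s 1 * β.g s (β.w j) = (if s = j then 1 else 0) + ρ s * σ j)
    (hρ : ∃ s ∈ O, ρ s ≠ 0) (Y : Matrix (Fin m) (Fin n) k) :
    ∑ s ∈ O, σ s * (β.f s 1 * β.g s Y) = 0 := by
  obtain ⟨s₀, hs₀, hρs₀⟩ := hρ
  have h := congrArg (fun Y' => β.f s₀ 1 * β.g s₀ Y') (eq_sum_off_one β O hO Y)
  simp only [map_sum, map_smul, smul_eq_mul, Finset.mul_sum] at h
  have h' : β.f s₀ 1 * β.g s₀ Y = ∑ j ∈ O, β.f j 1 * β.g j Y * (β.f s₀ 1 * β.g s₀ (β.w j)) := by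
    rw [h]; exact Finset.sum_congr rfl fun j _ => by ring
  rw [Finset.sum_congr rfl fun j hj => by rw [hM s₀ hs₀ j hj]] at h'
  simp only [mul_add, Finset.sum_add_distrib, mul_ite, mul_one, mul_zero] at h'
  rw [Finset.sum_ite_eq O s₀, if_pos hs₀] at h'
  have h'' : ρ s₀ * ∑ s ∈ O, σ s * (β.f s 1 * β.g s Y) = 0 := by
    rw [Finset.mul_sum]
    have : ∑ j ∈ O, β.f j 1 * β.g j Y * (ρ s₀ * σ j) = 0 := by linear_combination h'.symm
    rw [← this]
    exact Finset.sum_congr rfl fun j _ => by ring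
  rcases mul_eq_zero.mp h'' with h0 | h0
  · exact absurd h0 hρs₀
  · exact h0

/-- **The defect coefficient vanishes at `X = 1`:** `Σ_{s∈O} l_s f_s(1) g_s(Y) = 0` when `σ_s = l_s σ_{j₀}` (`s ∈ O`), `σ_{j₀} ≠ 0`,
`ρ ≠ 0` on `O`. -/
theorem nearDefect_one [DecidableEq ι] (hO : ∀ i, i ∉ O → β.f i 1 = 0) {ρ σ l : ι → k}
    (hM : ∀ s ∈ O, ∀ j ∈ O, β.f s 1 * β.g s (β.w j) = (if s = j then 1 else 0) + ρ s * σ j)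
    (hρ : ∃ s ∈ O, ρ s ≠ 0) {j₀ : ι} (hσ : σ j₀ ≠ 0) (hl : ∀ j ∈ O, σ j = l j * σ j₀)
    (Y : Matrix (Fin m) (Fin n) k) : ∑ s ∈ O, l s * (β.f s 1 * β.g s Y) = 0 := by
  have h := sum_sigma_gamma_eq_zero β O hO hM hρ Y
  rw [Finset.sum_congr rfl fun s hs => by rw [hl s hs]] at h
  have h' : (∑ s ∈ O, l s * (β.f s 1 * β.g s Y)) * σ j₀ = 0 := by
    rw [Finset.sum_mul, ← h]; exact Finset.sum_congr rfl fun s _ => by ring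
  rcases mul_eq_zero.mp h' with h0 | h0
  · exact h0
  · exact absurd h0 hσ

/-- **Brent's identity in the reduced frame (NEAR-FRAME §6).** For ANY `j₀` and coefficients `l` with `l_{j₀} = 1`:
`X Y = Σ_{j∈O∖{j₀}} f_j(X) g_j(Y) · (W_j − l_j W_{j₀}) + (Σ_{s∈O} l_s f_s(X) g_s(Y)) · W_{j₀} + Σ_{t∉O} f_t(X) g_t(Y) W_t`
(a formal regrouping of the `O`-part; with `σ_j = l_j σ_{j₀}` the middle coefficient is the defect `e(X,Y)`, `e(1,·) = 0`). -/
theorem mul_eq_nearBrent [DecidableEq ι] {l : ι → k} {j₀ : ι} (hl₀ : l j₀ = 1)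
    (X : Matrix (Fin m) (Fin m) k) (Y : Matrix (Fin m) (Fin n) k) :
    X * Y = ∑ j ∈ O.erase j₀, (β.f j X * β.g j Y) • (β.w j - l j • β.w j₀) +
      (∑ s ∈ O, l s * (β.f s X * β.g s Y)) • β.w j₀ + ∑ t ∈ Finset.univ \ O, (β.f t X * β.g t Y) • β.w t := by
  have h := β.map_eq_sum X Y
  rw [mulBilin_apply] at h
  rw [h, ← Finset.sum_sdiff (Finset.subset_univ O), add_comm]
  congr 1
  -- regroup the `O`-part
  have hsplit : ∀ s ∈ O, (β.f s X * β.g s Y) • β.w s =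
      (β.f s X * β.g s Y) • (β.w s - l s • β.w j₀) + (l s * (β.f s X * β.g s Y)) • β.w j₀ := by
    intro s _
    rw [smul_sub, smul_smul, mul_comm (l s), sub_add_cancel]
  rw [Finset.sum_congr rfl hsplit, Finset.sum_add_distrib, ← Finset.sum_smul]
  congr 1
  rw [← Finset.sum_erase O (f := fun s => (β.f s X * β.g s Y) • (β.w s - l s • β.w j₀))]
  rw [hl₀, one_smul, sub_self, smul_zero]

/-- **Transport on the common kernel, with defect.** If `W` is killed by every `g_t`, `t ∉ O`, then for `s ∈ O` and every `X`:
`f_s(1) g_s(XW) = f_s(X) g_s(W) + ρ_s · Σ_{s'∈O} σ_{s'} f_{s'}(X) g_{s'}(W)` (Brent on `K₀`, then the rank-one identity). The last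
sum is `σ_{j₀} e(X,W)`; where it vanishes the saturated-case transport `f_s(1) g_s(XW) = f_s(X) g_s(W)` holds exactly. -/
theorem near_transport [DecidableEq ι] {ρ σ : ι → k}
    (hM : ∀ s ∈ O, ∀ j ∈ O, β.f s 1 * β.g s (β.w j) = (if s = j then 1 else 0) + ρ s * σ j)
    {W : Matrix (Fin m) (Fin n) k} (hW : ∀ t, t ∉ O → β.g t W = 0) {s : ι} (hs : s ∈ O) (X : Matrix (Fin m) (Fin m) k) :
    β.f s 1 * β.g s (X * W) = β.f s X * β.g s W + ρ s * ∑ s' ∈ O, σ s' * (β.f s' X * β.g s' W) := by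
  have hB := β.map_eq_sum X W
  rw [mulBilin_apply] at hB
  have hXW : X * W = ∑ s' ∈ O, (β.f s' X * β.g s' W) • β.w s' := by
    rw [hB, ← Finset.sum_subset (Finset.subset_univ O)]
    intro i _ hi
    rw [hW i hi, mul_zero, zero_smul]
  rw [hXW, map_sum, Finset.mul_sum]
  have hterm : ∀ s' ∈ O, β.f s 1 * β.g s ((β.f s' X * β.g s' W) • β.w s') =
      (if s = s' then β.f s X * β.g s W else 0) + ρ s * (σ s' * (β.f s' X * β.g s' W)) := by
    intro s' hs'
    rw [map_smul, smul_eq_mul, mul_left_comm, hM s hs s' hs']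
    split_ifs with hss'
    · subst hss'; ring
    · ring
  rw [Finset.sum_congr rfl hterm, Finset.sum_add_distrib, Finset.sum_ite_eq O s, if_pos hs, ← Finset.mul_sum]

/-- **(N4b) The reduced vectors form a basis.** With `ρ, σ` as in `exists_nearFrame` (`Σρ_jW_j = 0`, `Σρ_sσ_s = −1`),
`σ_{j₀} ≠ 0` and `σ_j = l_j σ_{j₀}` (`j ∈ O`): the `m·n` vectors `W_j − l_j W_{j₀}` (`j ∈ O ∖ {j₀}`) are linearly independent,
hence a basis of `k^{m×n}`. (They span: `W_{j₀} = −σ_{j₀} Σ_{j≠j₀} ρ_j (W_j − l_j W_{j₀})` from the relation, and the `W_j`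
span; then count.) -/
theorem linearIndependent_nearBasis [DecidableEq ι] (hO : ∀ i, i ∉ O → β.f i 1 = 0) (hcard : O.card = m * n + 1)
    {ρ σ l : ι → k} (hrel : ∑ j ∈ O, ρ j • β.w j = 0) (hρσ : ∑ s ∈ O, ρ s * σ s = -1)
    {j₀ : ι} (hj₀ : j₀ ∈ O) (hσ : σ j₀ ≠ 0) (hl : ∀ j ∈ O, σ j = l j * σ j₀) :
    LinearIndependent k (fun j : ↥(O.erase j₀) => β.w j - l j • β.w j₀) := by
  have hl₀ : l j₀ = 1 := by
    have := hl j₀ hj₀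
    rcases mul_eq_zero.mp (show (l j₀ - 1) * σ j₀ = 0 by linear_combination -this) with h0 | h0
    · exact (sub_eq_zero.mp h0)
    · exact absurd h0 hσ
  set S := Submodule.span k (Set.range fun j : ↥(O.erase j₀) => β.w j - l j • β.w j₀) with hS
  -- `W_{j₀} ∈ S`
  have hsum_l : (∑ j ∈ O, ρ j * l j) * σ j₀ = -1 := by
    rw [Finset.sum_mul, ← hρσ]
    exact Finset.sum_congr rfl fun j hj => by rw [hl j hj]; ring
  have hc : ∑ j ∈ O, ρ j * l j ≠ 0 := by
    intro h0; rw [h0, zero_mul] at hsum_l; exact (neg_ne_zero.mpr one_ne_zero) hsum_l.symm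
  have hmemS : ∀ j ∈ O.erase j₀, β.w j - l j • β.w j₀ ∈ S := fun j hj => Submodule.subset_span ⟨⟨j, hj⟩, rfl⟩
  have hsplit : ∑ j ∈ O.erase j₀, ρ j • (β.w j - l j • β.w j₀) + (∑ j ∈ O, ρ j * l j) • β.w j₀ = 0 := by
    rw [Finset.sum_erase O (f := fun j => ρ j • (β.w j - l j • β.w j₀))
      (by simp only [hl₀, one_smul, sub_self, smul_zero]), Finset.sum_smul, ← Finset.sum_add_distrib, ← hrel]
    exact Finset.sum_congr rfl fun j _ => by rw [smul_sub, smul_smul, sub_add_cancel]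
  have hj₀S : β.w j₀ ∈ S := by
    have h1 : (∑ j ∈ O, ρ j * l j) • β.w j₀ = -∑ j ∈ O.erase j₀, ρ j • (β.w j - l j • β.w j₀) :=
      eq_neg_of_add_eq_zero_right hsplit
    have h2 : β.w j₀ = (∑ j ∈ O, ρ j * l j)⁻¹ • -∑ j ∈ O.erase j₀, ρ j • (β.w j - l j • β.w j₀) := by
      rw [← h1, smul_smul, inv_mul_cancel₀ hc, one_smul]
    rw [h2]
    exact Submodule.smul_mem _ _ (Submodule.neg_mem _ (Submodule.sum_mem _ fun j hj =>
      Submodule.smul_mem _ _ (hmemS j hj)))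
  -- every `W_j`, `j ∈ O`, lies in `S`, hence `S = ⊤`
  have hWS : ∀ j ∈ O, β.w j ∈ S := by
    intro j hj
    by_cases hjj : j = j₀
    · rw [hjj]; exact hj₀S
    · have h := hmemS j (Finset.mem_erase.mpr ⟨hjj, hj⟩)
      have : β.w j = (β.w j - l j • β.w j₀) + l j • β.w j₀ := (sub_add_cancel _ _).symm
      rw [this]
      exact Submodule.add_mem _ h (Submodule.smul_mem _ _ hj₀S)
  have htop : ⊤ ≤ S := by
    refine (top_le_span_w_off β 1 isUnit_det_one_fin O hO).trans (Submodule.span_le.mpr ?_)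
    rintro _ ⟨⟨j, hj⟩, rfl⟩
    exact hWS j hj
  refine linearIndependent_of_top_le_span_of_card_eq_finrank htop ?_
  rw [Fintype.card_coe, Finset.card_erase_of_mem hj₀, hcard, finrank_matrix_fin]
  omega

end NearFrame


end Summit.MatrixMultiplication.OmegaCensus.SmallFormats
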